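import Summits.RiemannHypothesis.RiemannHypothesis.Theorems.HandoffDodgerEdgeValue
import Summits.RiemannHypothesis.RiemannHypothesis.Theorems.HandoffDodgerMomentExpansion
import Summits.RiemannHypothesis.RiemannHypothesis.Theorems.HandoffDodgerNewton
import Summits.RiemannHypothesis.RiemannHypothesis.Theorems.HandoffDodgerMajorant
import Summits.RiemannHypothesis.RiemannHypothesis.Theorems.HandoffDodgerProfileBound
import Summits.RiemannHypothesis.RiemannHypothesis.Theorems.HandoffDodgerProfileDefs
import HarnessLib

/-!
# HANDOFF — PROFILE CONTROL on the collar: `Re F₀(b−σ) ≥ κ·(c_∞/2b)·Φ(p₁σ²)` (ATTEMPT-16 Lemma D1, assembled) (rh-explicit, track «HANDOFF», seat prove-2 gen10, ATTEMPT-19 §5)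

HONEST FRAMING. Nothing here bears on the truth of RH; this assembles the elementary bricks of the D1 chain. `F₀` is the dodger
`cutoffCosPoly b K (dodgerCoeff b T K)` (`K = N(T)`), `c_∞/(2b) = F₀(b)` (`HandoffDodgerEdgeValue`), `p₁ = Re S_1` the first power sum
(`HandoffDodgerPowerSums`), `Φ = dodgerPhi`.
(1) THE PROFILE IDENTITY (`hasSum_dodger_profile`): for `0 ≤ σ ≤ 2b`,

  `HasSum (m ↦ b_m·σ^{2m}/(2m)!) ((2b/c_∞)·Re F₀(b−σ))`,   `b_m := (−1)^m·Re h_m`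

(`h` = the coefficients of `H = P̃/Λ̃`; from `re_cutoffCosPoly_dodger_edge_sub`, `hasSum_sum_mul_sin_sq_half` and `M_n = [n=0] − c_∞h_n`).
(2) THE SIZE HYPOTHESES (`abs_profileCoeff_sub_le`, `abs_profileCoeff_le`): under the clean horizon `N ≤ Λ_K` on `[0,T]` (`πK/b ≤ T`)
and `p₁ > 0`, with `W = T² + ¼`, `P = p₁ + K(T+½)`: `|b_m − p₁^m/m!| ≤ (p₁^m/m!)(exp(2PWm²/p₁²) − 1)` for `W·m ≤ p₁/2` and
`|b_m| ≤ e^{(p₁+P)/(2W)}(2W)^m` for all `m` (`HandoffDodgerNewton` ⊕ `HandoffDodgerPowerSums` ⊕ `HandoffDodgerMajorant`).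
(3) **PROFILE CONTROL** (`re_dodger_edge_sub_ge`): with `HandoffDodgerProfileBound.profile_lower_bound`, for `0 ≤ σ ≤ 2δ ≤ 2b`,

  `Re F₀(b−σ) ≥ (1 − η − 3τ₁ − τ₂)·(c_∞/2b)·Φ(p₁σ²)`

under the explicit parameter inequalities of that lemma (`N₁ ≤ N₂`, `W·N₂ ≤ p₁/2`, `η, λ, ρ₁, ρ₂, τ₁, τ₂, X` free upper bounds). This is the
monotone minorant `m(σ)` consumed by `HandoffDodgerCollar`. No `sorry`, standard axioms, no definitions.

References: this track (ATTEMPT-16 §5 Lemma D1; ATTEMPT-18 §3 (R-3); ATTEMPT-19 §5).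
-/

set_option linter.dupNamespace false

noncomputable section

open Complex Finset
open scoped Real

namespace Summit.RiemannHypothesis.RiemannHypothesis.Theorems.Handoff

open Literature.NumberTheory.LFunctions Literature.NumberTheory.LFunctions.SchoenfeldBound

/-! ## The profile identity -/

/-- `Re M_n = Σ_k Re(w_k)·ℓ_{k+1}^{2n}`. [this track, ATTEMPT-19 §5] -/
theorem re_dodgerMoment_eq (b T : ℝ) (n : ℕ) :
    (dodgerMoment b T n).re =
      ∑ k : Fin (zetaZeroCount T), (dodgerWeight b T k).re * (latticeFreq b (k.val + 1)) ^ (2 * n) := by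
  rw [dodgerMoment, Complex.re_sum]
  refine Finset.sum_congr rfl fun k _ => ?_
  rw [← Complex.ofReal_pow, Complex.re_mul_ofReal, ← pow_mul]

/-- `Re M_{n+1} = −c_∞·Re h_{n+1}` with the REAL constant `c_∞`. [this track, ATTEMPT-19 §5] -/
theorem re_dodgerMoment_succ {b : ℝ} (hb : 0 < b) (T : ℝ) (n : ℕ) :
    (dodgerMoment b T (n + 1)).re =
      -((∏ k ∈ Finset.range (zetaZeroCount T), (latticeFreq b (k + 1)) ^ 2) /
          ∏ ρ ∈ zerosBetween 0 T, ‖dodgerNode ρ‖ ^ (2 * (riemannZetaZeroOrder ρ).toNat)) *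
        (PowerSeries.coeff (n + 1) (dodgerH b T)).re := by
  rw [dodgerMoment_succ_eq hb T n, dodgerCinfC_eq_ofReal, Complex.neg_re, Complex.re_ofReal_mul, neg_mul]

/-- **The profile identity**: for `0 ≤ σ ≤ 2b`, `HasSum (m ↦ (−1)^m·Re h_m·σ^{2m}/(2m)!) ((2b/c_∞)·Re F₀(b−σ))`.
[this track, ATTEMPT-16 §2 Lemma A3; ATTEMPT-19 §5] -/
theorem hasSum_dodger_profile {b : ℝ} (hb : 0 < b) (T : ℝ) {σ : ℝ} (h0 : 0 ≤ σ) (h2 : σ ≤ 2 * b) :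
    HasSum (fun m : ℕ => (-1) ^ m * (PowerSeries.coeff m (dodgerH b T)).re * σ ^ (2 * m) / ((2 * m).factorial : ℝ))
      ((2 * b / ((∏ k ∈ Finset.range (zetaZeroCount T), (latticeFreq b (k + 1)) ^ 2) /
          ∏ ρ ∈ zerosBetween 0 T, ‖dodgerNode ρ‖ ^ (2 * (riemannZetaZeroOrder ρ).toNat))) *
        (cutoffCosPoly b (zetaZeroCount T) (dodgerCoeff b T (zetaZeroCount T)) (b - σ)).re) := by
  set cR := (∏ k ∈ Finset.range (zetaZeroCount T), (latticeFreq b (k + 1)) ^ 2) /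
      ∏ ρ ∈ zerosBetween 0 T, ‖dodgerNode ρ‖ ^ (2 * (riemannZetaZeroOrder ρ).toNat) with hcR
  have hcR0 : 0 < cR := by
    have h1 : 0 < ∏ k ∈ Finset.range (zetaZeroCount T), (latticeFreq b (k + 1)) ^ 2 :=
      Finset.prod_pos fun k _ => by unfold latticeFreq; positivity
    exact div_pos h1 (prod_norm_dodgerNode_pow_pos T)
  -- the sin² sum as a power series in `σ²` with moments `Re M_{n+1} = −c_∞ Re h_{n+1}`
  have hsin := hasSum_sum_mul_sin_sq_half (Finset.univ : Finset (Fin (zetaZeroCount T)))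
    (fun k => (dodgerWeight b T k).re) (fun k => latticeFreq b (k.val + 1)) σ
  have hmom : ∀ n : ℕ, ∑ k : Fin (zetaZeroCount T), (dodgerWeight b T k).re * (latticeFreq b (k.val + 1)) ^ (2 * n + 2) =
      -cR * (PowerSeries.coeff (n + 1) (dodgerH b T)).re := by
    intro n
    rw [show 2 * n + 2 = 2 * (n + 1) by ring, ← re_dodgerMoment_eq, re_dodgerMoment_succ hb]
  simp only [hmom] at hsin
  -- the edge representation
  have hedge := re_cutoffCosPoly_dodger_edge_sub hb T h0 h2
  set Ssum := ∑ k : Fin (zetaZeroCount T), (dodgerWeight b T k).re * Real.sin (latticeFreq b (k.val + 1) * σ / 2) ^ 2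
    with hSsum
  have hedge' : (cutoffCosPoly b (zetaZeroCount T) (dodgerCoeff b T (zetaZeroCount T)) (b - σ)).re =
      1 / (2 * b) * cR + 1 / b * Ssum := by
    rw [hedge, hSsum, hcR]
    rfl
  -- shift by one and rescale
  have htail : HasSum (fun n : ℕ => (-1) ^ (n + 1) * (PowerSeries.coeff (n + 1) (dodgerH b T)).re * σ ^ (2 * (n + 1)) /
      ((2 * (n + 1)).factorial : ℝ))
      (2 / cR * ∑ k : Fin (zetaZeroCount T), (dodgerWeight b T k).re * Real.sin (latticeFreq b (k.val + 1) * σ / 2) ^ 2) := by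
    have h := hsin.mul_left (2 / cR)
    refine h.congr_fun fun n => ?_
    rw [show 2 * (n + 1) = 2 * n + 2 by ring]
    field_simp
    ring
  have h1 : HasSum (fun m : ℕ => (-1) ^ m * (PowerSeries.coeff m (dodgerH b T)).re * σ ^ (2 * m) / ((2 * m).factorial : ℝ))
      (2 / cR * (∑ k : Fin (zetaZeroCount T), (dodgerWeight b T k).re * Real.sin (latticeFreq b (k.val + 1) * σ / 2) ^ 2) + 1) := by
    refine (hasSum_nat_add_iff' 1).1 ?_
    have e : ∑ i ∈ Finset.range 1, (-1 : ℝ) ^ i * (PowerSeries.coeff i (dodgerH b T)).re * σ ^ (2 * i) / ((2 * i).factorial : ℝ) = 1 := by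
      simp [coeff_zero_dodgerH]
    rw [e, add_sub_cancel_right]
    exact htail
  have e2 : 2 / cR * (∑ k : Fin (zetaZeroCount T), (dodgerWeight b T k).re * Real.sin (latticeFreq b (k.val + 1) * σ / 2) ^ 2) + 1 =
      2 * b / cR * (cutoffCosPoly b (zetaZeroCount T) (dodgerCoeff b T (zetaZeroCount T)) (b - σ)).re := by
    rw [hedge']
    field_simp
    ring
  rw [e2] at h1
  exact h1

/-! ## The size hypotheses for `b_m = (−1)^m Re h_m` -/

/-- **Main-range size**: under the clean horizon and `p₁ > 0`, for `(T²+¼)·m ≤ p₁/2`,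
`|(−1)^m Re h_m − p₁^m/m!| ≤ (p₁^m/m!)(exp(2PWm²/p₁²) − 1)`, `W = T²+¼`, `P = p₁ + K(T+½)`. [this track, ATTEMPT-16 §5 Lemma D1 (i)–(ii); ATTEMPT-19 §5] -/
theorem abs_profileCoeff_sub_le {b T : ℝ} (hb : 0 < b) (hT : 0 ≤ T) (hK : π * (zetaZeroCount T) / b ≤ T)
    (hΔ : ∀ t ∈ Set.Icc 0 T, (zetaZeroCount t : ℝ) - ((min ⌊b * t / π⌋₊ (zetaZeroCount T) : ℕ) : ℝ) ≤ 0)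
    (hp : 0 < (dodgerPowerSum b T 1).re) {m : ℕ} (hm : (T ^ 2 + 1 / 4) * m ≤ (dodgerPowerSum b T 1).re / 2) :
    |(-1) ^ m * (PowerSeries.coeff m (dodgerH b T)).re - (dodgerPowerSum b T 1).re ^ m / (m.factorial : ℝ)| ≤
      (dodgerPowerSum b T 1).re ^ m / (m.factorial : ℝ) *
        (Real.exp (2 * ((dodgerPowerSum b T 1).re + (zetaZeroCount T : ℝ) * (T + 1 / 2)) * (T ^ 2 + 1 / 4) * (m : ℝ) ^ 2 /
          (dodgerPowerSum b T 1).re ^ 2) - 1) := by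
  obtain ⟨hr0, hrec, hconv⟩ := dodgerH_cumulant_form b T
  have hW : (0 : ℝ) ≤ T ^ 2 + 1 / 4 := by positivity
  have hP : (0 : ℝ) ≤ (dodgerPowerSum b T 1).re + (zetaZeroCount T : ℝ) * (T + 1 / 2) := by positivity
  have hS : ∀ j, 2 ≤ j → ‖dodgerPowerSum b T j‖ ≤
      (j : ℝ) * (T ^ 2 + 1 / 4) ^ (j - 1) * ((dodgerPowerSum b T 1).re + (zetaZeroCount T : ℝ) * (T + 1 / 2)) :=
    fun j hj => norm_dodgerPowerSum_le_geometric hb hT hK hΔ (by omega)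
  have h := norm_sub_le_of_geometric (S := dodgerPowerSum b T) (r := fun n => PowerSeries.coeff n (dodgerR b T))
    (h := fun n => PowerSeries.coeff n (dodgerH b T)) hp hW hP hr0 hrec hS hconv hm
  refine le_trans ?_ h
  have e : (-1 : ℝ) ^ m * (PowerSeries.coeff m (dodgerH b T)).re - (dodgerPowerSum b T 1).re ^ m / (m.factorial : ℝ) =
      (-1) ^ m * (PowerSeries.coeff m (dodgerH b T) -
        ((-(dodgerPowerSum b T 1).re : ℝ) : ℂ) ^ m / (m.factorial : ℂ)).re := by
    have hre : ((((-(dodgerPowerSum b T 1).re : ℝ) : ℂ) ^ m / (m.factorial : ℂ))).re =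
        (-(dodgerPowerSum b T 1).re) ^ m / (m.factorial : ℝ) := by
      rw [← Complex.ofReal_pow, ← Complex.ofReal_natCast, ← Complex.ofReal_div, Complex.ofReal_re]
    rw [Complex.sub_re, hre, neg_pow (dodgerPowerSum b T 1).re, mul_sub]
    congr 1
    rw [mul_div_assoc', ← mul_assoc, ← mul_pow, show (-1 : ℝ) * -1 = 1 by norm_num, one_pow, one_mul]
  rw [e, abs_mul, abs_pow, abs_neg, abs_one, one_pow, one_mul]
  exact Complex.abs_re_le_norm _

/-- **Tail size**: under the clean horizon and `p₁ ≥ 0`, for every `m`: `|(−1)^m Re h_m| ≤ e^{(p₁+P)/(2W)}·(2W)^m`.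
[this track, ATTEMPT-19 §2, §5] -/
theorem abs_profileCoeff_le {b T : ℝ} (hb : 0 < b) (hT : 0 ≤ T) (hK : π * (zetaZeroCount T) / b ≤ T)
    (hΔ : ∀ t ∈ Set.Icc 0 T, (zetaZeroCount t : ℝ) - ((min ⌊b * t / π⌋₊ (zetaZeroCount T) : ℕ) : ℝ) ≤ 0)
    (hp : 0 ≤ (dodgerPowerSum b T 1).re) (m : ℕ) :
    |(-1) ^ m * (PowerSeries.coeff m (dodgerH b T)).re| ≤
      Real.exp (((dodgerPowerSum b T 1).re + ((dodgerPowerSum b T 1).re + (zetaZeroCount T : ℝ) * (T + 1 / 2))) /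
          (2 * (T ^ 2 + 1 / 4))) * (2 * (T ^ 2 + 1 / 4)) ^ m := by
  obtain ⟨hr0, hrec, hconv⟩ := dodgerH_cumulant_form b T
  have hW0 : (0 : ℝ) < T ^ 2 + 1 / 4 := by positivity
  have hP : (0 : ℝ) ≤ (dodgerPowerSum b T 1).re + (zetaZeroCount T : ℝ) * (T + 1 / 2) := by positivity
  have hS : ∀ j, 2 ≤ j → ‖dodgerPowerSum b T j‖ ≤
      (j : ℝ) * (T ^ 2 + 1 / 4) ^ (j - 1) * ((dodgerPowerSum b T 1).re + (zetaZeroCount T : ℝ) * (T + 1 / 2)) :=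
    fun j hj => norm_dodgerPowerSum_le_geometric hb hT hK hΔ (by omega)
  have hu : (0 : ℝ) < 1 / (2 * (T ^ 2 + 1 / 4)) := by positivity
  have hWu : (T ^ 2 + 1 / 4) * (1 / (2 * (T ^ 2 + 1 / 4))) ≤ 1 / 2 := by
    rw [← mul_div_assoc, mul_one, div_le_iff₀ (by positivity)]; linarith
  have h := norm_le_of_geometric (S := dodgerPowerSum b T) (r := fun n => PowerSeries.coeff n (dodgerR b T))
    (h := fun n => PowerSeries.coeff n (dodgerH b T)) hp hW0.le hP hr0 hrec hS hconv m hu hWu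
  rw [abs_mul, abs_pow, abs_neg, abs_one, one_pow, one_mul]
  refine (Complex.abs_re_le_norm _).trans (h.trans (le_of_eq ?_))
  rw [show (1 / (2 * (T ^ 2 + 1 / 4))) ^ m = ((2 * (T ^ 2 + 1 / 4)) ^ m)⁻¹ by rw [one_div, inv_pow], div_inv_eq_mul]
  congr 2
  field_simp

/-! ## Profile control -/

set_option maxHeartbeats 400000 in
/-- **ATTEMPT-16 Lemma D1 (profile control on the collar), kernel form.** Under the clean horizon (`N ≤ Λ_K` on `[0,T]`,
`πK/b ≤ T`), `p₁ := Re S_1 > 0`, and the parameter inequalities of `profile_lower_bound` with `W = T²+¼`, `P = p₁ + K(T+½)`,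
`E = e^{(p₁+P)/(2W)}`, `σ_max = 2δ ≤ 2b`: for every `σ ∈ [0, 2δ]`,
`(1 − η − 3τ₁ − τ₂)·(c_∞/2b)·Φ(p₁σ²) ≤ Re F₀(b−σ)`. [this track, ATTEMPT-16 §5 Lemma D1; ATTEMPT-19 §5] -/
theorem re_dodger_edge_sub_ge {b T δ : ℝ} (hb : 0 < b) (hT : 0 ≤ T) (hK : π * (zetaZeroCount T) / b ≤ T)
    (hΔ : ∀ t ∈ Set.Icc 0 T, (zetaZeroCount t : ℝ) - ((min ⌊b * t / π⌋₊ (zetaZeroCount T) : ℕ) : ℝ) ≤ 0)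
    (hp : 0 < (dodgerPowerSum b T 1).re) (hδb : δ ≤ b)
    {N₁ N₂ : ℕ} (hN : N₁ ≤ N₂) (hWN : (T ^ 2 + 1 / 4) * N₂ ≤ (dodgerPowerSum b T 1).re / 2)
    {X η lam ρ₁ ρ₂ τ₁ τ₂ : ℝ} (hX : (dodgerPowerSum b T 1).re * (2 * δ) ^ 2 ≤ X)
    (hη : Real.exp (2 * ((dodgerPowerSum b T 1).re + (zetaZeroCount T : ℝ) * (T + 1 / 2)) * (T ^ 2 + 1 / 4) * (N₁ : ℝ) ^ 2 /
        (dodgerPowerSum b T 1).re ^ 2) - 1 ≤ η)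
    (hlam : 2 * ((dodgerPowerSum b T 1).re + (zetaZeroCount T : ℝ) * (T + 1 / 2)) * (T ^ 2 + 1 / 4) * (N₂ : ℝ) /
        (dodgerPowerSum b T 1).re ^ 2 ≤ lam)
    (hρ₁ : Real.exp (3 + lam) * X / (4 * ((N₁ : ℝ) + 1) ^ 3) ≤ ρ₁) (hρ₁1 : ρ₁ < 1)
    (hρ₂ : Real.exp 2 * (T ^ 2 + 1 / 4) * (2 * δ) ^ 2 / (2 * ((N₂ : ℝ) + 1) ^ 2) ≤ ρ₂) (hρ₂1 : ρ₂ < 1)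
    (hτ₁ : ρ₁ ^ (N₁ + 1) / (1 - ρ₁) ≤ τ₁)
    (hτ₂ : Real.exp (((dodgerPowerSum b T 1).re + ((dodgerPowerSum b T 1).re + (zetaZeroCount T : ℝ) * (T + 1 / 2))) /
        (2 * (T ^ 2 + 1 / 4))) * ρ₂ ^ (N₂ + 1) / (1 - ρ₂) ≤ τ₂)
    {σ : ℝ} (hσ0 : 0 ≤ σ) (hσ : σ ≤ 2 * δ) :
    (1 - η - 3 * τ₁ - τ₂) *
        ((1 / (2 * b)) * ((∏ k ∈ Finset.range (zetaZeroCount T), (latticeFreq b (k + 1)) ^ 2) /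
          ∏ ρ ∈ zerosBetween 0 T, ‖dodgerNode ρ‖ ^ (2 * (riemannZetaZeroOrder ρ).toNat))) *
        dodgerPhi ((dodgerPowerSum b T 1).re * σ ^ 2) ≤
      (cutoffCosPoly b (zetaZeroCount T) (dodgerCoeff b T (zetaZeroCount T)) (b - σ)).re := by
  set p := (dodgerPowerSum b T 1).re with hpdef
  set W : ℝ := T ^ 2 + 1 / 4 with hWdef
  set P : ℝ := p + (zetaZeroCount T : ℝ) * (T + 1 / 2) with hPdef
  set E : ℝ := Real.exp ((p + P) / (2 * W)) with hEdef
  set cR := (∏ k ∈ Finset.range (zetaZeroCount T), (latticeFreq b (k + 1)) ^ 2) /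
      ∏ ρ ∈ zerosBetween 0 T, ‖dodgerNode ρ‖ ^ (2 * (riemannZetaZeroOrder ρ).toNat) with hcR
  have hcR0 : 0 < cR := by
    have h1 : 0 < ∏ k ∈ Finset.range (zetaZeroCount T), (latticeFreq b (k + 1)) ^ 2 :=
      Finset.prod_pos fun k _ => by unfold latticeFreq; positivity
    exact div_pos h1 (prod_norm_dodgerNode_pow_pos T)
  have hW0 : 0 < W := by positivity
  have hP0 : 0 ≤ P := by positivity
  have hσb : σ ≤ 2 * b := by linarith
  -- the size hypotheses
  have H1 : ∀ m : ℕ, m ≤ N₂ → |(-1) ^ m * (PowerSeries.coeff m (dodgerH b T)).re - p ^ m / (m.factorial : ℝ)| ≤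
      p ^ m / (m.factorial : ℝ) * (Real.exp (2 * P * W * (m : ℝ) ^ 2 / p ^ 2) - 1) := by
    intro m hm
    have hm' : (T ^ 2 + 1 / 4) * m ≤ (dodgerPowerSum b T 1).re / 2 :=
      le_trans (mul_le_mul_of_nonneg_left (by exact_mod_cast hm) hW0.le) hWN
    exact abs_profileCoeff_sub_le hb hT hK hΔ hp hm'
  have H2 : ∀ m : ℕ, N₂ < m → |(-1) ^ m * (PowerSeries.coeff m (dodgerH b T)).re| ≤ E * (2 * W) ^ m :=
    fun m _ => abs_profileCoeff_le hb hT hK hΔ hp.le m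
  -- the two sums
  have hS := hasSum_dodger_profile hb T hσ0 hσb
  have hΦ : HasSum (fun m : ℕ => (p * σ ^ 2) ^ m / ((m.factorial : ℝ) * ((2 * m).factorial : ℝ))) (dodgerPhi (p * σ ^ 2)) :=
    hasSum_dodgerPhi (p * σ ^ 2)
  have hσX : p * σ ^ 2 ≤ X := by
    refine le_trans ?_ hX
    have : σ ^ 2 ≤ (2 * δ) ^ 2 := pow_le_pow_left₀ hσ0 hσ (2 : ℕ)
    exact mul_le_mul_of_nonneg_left this hp.le
  have hρ₂' : Real.exp 2 * W * σ ^ 2 / (2 * ((N₂ : ℝ) + 1) ^ 2) ≤ ρ₂ := by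
    refine le_trans ?_ hρ₂
    have : σ ^ 2 ≤ (2 * δ) ^ 2 := pow_le_pow_left₀ hσ0 hσ (2 : ℕ)
    gcongr
  have key := profile_lower_bound (b := fun m => (-1) ^ m * (PowerSeries.coeff m (dodgerH b T)).re) hp hW0.le hP0
    (Real.exp_pos _).le hN H1 H2 hσ0 hσX hη hlam hρ₁ hρ₁1 hρ₂' hρ₂1 hτ₁ hτ₂
    (S := 2 * b / cR * (cutoffCosPoly b (zetaZeroCount T) (dodgerCoeff b T (zetaZeroCount T)) (b - σ)).re)
    (hS.congr_fun fun m => by ring) hΦ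
  -- rescale by `c_∞/(2b) > 0`
  have hfac : 0 < 1 / (2 * b) * cR := by positivity
  have e : (cutoffCosPoly b (zetaZeroCount T) (dodgerCoeff b T (zetaZeroCount T)) (b - σ)).re =
      (1 / (2 * b) * cR) * (2 * b / cR * (cutoffCosPoly b (zetaZeroCount T) (dodgerCoeff b T (zetaZeroCount T)) (b - σ)).re) := by
    field_simp
  rw [e]
  calc (1 - η - 3 * τ₁ - τ₂) * (1 / (2 * b) * cR) * dodgerPhi (p * σ ^ 2)
      = (1 / (2 * b) * cR) * ((1 - η - 3 * τ₁ - τ₂) * dodgerPhi (p * σ ^ 2)) := by ring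
    _ ≤ (1 / (2 * b) * cR) * (2 * b / cR * (cutoffCosPoly b (zetaZeroCount T) (dodgerCoeff b T (zetaZeroCount T)) (b - σ)).re) :=
        mul_le_mul_of_nonneg_left key hfac.le

end Summit.RiemannHypothesis.RiemannHypothesis.Theorems.Handoff

end
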